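import Summits.KontsevichZagierPeriods.KontsevichZagierPeriods.Theses.SymplecticScissors
import Summits.KontsevichZagierPeriods.KontsevichZagierPeriods.Theses.DimensionBudget
import Summits.KontsevichZagierPeriods.KontsevichZagierPeriods.Theorems.LiftingCriteriaCubeNashNormalFormDimLeOne
import Summits.KontsevichZagierPeriods.KontsevichZagierPeriods.Theorems.SymplecticScissorsCubeNashNormalFormChartCompiler
import Summits.KontsevichZagierPeriods.KontsevichZagierPeriods.Theorems.SymplecticScissorsCubeNashNormalFormCubeMonomializationOne
import Summits.KontsevichZagierPeriods.KontsevichZagierPeriods.Theorems.SymplecticScissorsCubeNashNormalFormAbhyankarJung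
import Summits.KontsevichZagierPeriods.KontsevichZagierPeriods.Theorems.SymplecticScissorsCubeNashNormalFormToricPrincipalization
import Summits.KontsevichZagierPeriods.KontsevichZagierPeriods.Theorems.SymplecticScissorsCubeNashNormalFormRootDifferenceDivisor
import Summits.KontsevichZagierPeriods.KontsevichZagierPeriods.Theorems.SymplecticScissorsCubeNashNormalFormJungPrepare
import Summits.KontsevichZagierPeriods.KontsevichZagierPeriods.Theorems.SymplecticScissorsCubeNashNormalFormJungFinish
import Mathlib.RingTheory.Polynomial.Resultant.Basic
import Mathlib.Analysis.Analytic.Basic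

/-!
# Crux `CubeNashNormalForm` (stmt-KontsevichZagierPeriods-3574) — line `Sketch`
# (card `jung-descent-abhyankar-toric`): JUNG'S INDUCTION, NOT HIRONAKA

Closing file of the line (leads prover-line-stmt-KontsevichZagierPeriods-3574-0 / -c1-0), built on the
card `Cruxes/CubeNashNormalForm/Ideas/jung-descent-abhyankar-toric.md`. It proves the crux BY NAME — all
three route decls `LiftingCriteria.CubeNashNormalForm` (home), `SymplecticScissors.CubeNashNormalForm`,
`DimensionBudget.CubeNashNormalForm` (byte-identical bodies) — from the seven landed stubs through the
landed reduction `LiftingCriteria.CubeNashNormalFormDimLeOne.cubeNashNormalForm_of_boundedCubeResolution_three`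
(dimensions `≤ 2` were already in the tree; the stubs supply: every bounded integrand-`1` solid of
dimension `≥ 3` is, modulo `KZ.relations`, in the span of TAME cube classes).

## Vocabulary (spelled out verbatim inside every stub; no defs, no notation)

* closed / open unit cube of `ℝᵈ`: `Set.pi Set.univ (fun _ => Set.Icc 0 1)` / `(… Set.Ioo 0 1)`.
* CHART FORMAT for `Φ : ℝᵈ → ℝᵈ`: analytic AT every point of the closed cube, `ℚ`-semialgebraic on the
  OPEN cube, injective on the open cube, `det DΦ ≠ 0` on the open cube. (Nothing is asked of `Φ` off the
  cube beyond analyticity at the closed cube; the compiler stub derives the Jacobian integrand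
  `g = ±det DΦ`, analytic near the closed cube and semialgebraic on it, and closes cubes through the
  landed fold `CubeNashNormalFormTame.of_mem_of_isTameCube`.)
* CUBE-MONOMIAL near the closed cube: `F = (∏ xᵢ^{aᵢ} (1 - xᵢ)^{bᵢ}) · e` on an open `U ⊇` closed cube
  with `e` analytic and nowhere zero on `U`.
* `E(d)` (cube-monomialization = the card's `CubeMonomialization d`): every bounded `ℚ`-semialgebraic
  `B ⊆ ℝᵈ` is, off a null set, the disjoint union of finitely many open-cube images of FORMAT charts
  along each of which every member of a prescribed finite family of non-zero polynomials over `ℚ` is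
  cube-monomial. With the EMPTY family, `E(m+3)` is verbatim a tame cell atlas of the solid.
* `AJ(d)` (Abhyankar–Jung near the closed cube): a monic `T`-polynomial with coefficients analytic on
  `U ⊇` closed cube whose discriminant `Res(P, P')` is `(∏ xᵢ^{αᵢ}) ·` (analytic unit) splits, after the
  ramification `xᵢ = σᵢ^N`, into linear factors `T − ζ_l(σ)` with `ζ_l : ℝᵈ → ℂ` analytic near the
  closed cube. [Abhyankar 1955; Jung 1908; Kiyek–Vicente 2004 Cor. V.3.3; Parusiński–Rond 2012]
* `TORIC(n)`: for a finite set of exponents there are finitely many monomial charts `v ↦ (∏ⱼ vⱼ^{A i j})ᵢ`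
  (`A ∈ ℕ^{n×n}`, `det A ≠ 0` — simplicial, unimodularity is NOT needed for real-analytic charts) whose
  open-cube images are pairwise disjoint and exhaust the open cube up to a null set, and along each of
  which the pulled-back exponents `Aᵀa` of the given set are pairwise comparable (simplicial refinement
  of the fan cut out by the hyperplanes `⟨a − b, ·⟩ = 0`). [Fulton 1993 §2.6; Goward 2005]
* `DIV(d)` (divisors of a normal-crossing monomial): if `f·g = (∏ xᵢ^{aᵢ})·e` with `f, g, e : ℝᵈ → ℂ`
  analytic on `U ⊇` closed cube and `e ≠ 0`, then `f = (∏ xᵢ^{bᵢ})·u`, `u` analytic and nowhere zero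
  near the closed cube (Newton-polyhedron argument in `ℂ{x − p}` at each point `p`, glued along faces).
* `PREP(d)` (output of JungPrepare): as `E(d+1)` but with each `Qⱼ ∘ Φᵢ` only in BINOMIAL PRODUCT FORM:
  (cube-monomial · unit) · ∏ (M₁e₁ + M₂e₂)^{m} · ∏ ((M₃e₃ + M₄e₄)² + M₅e₅)^{m'} with cube-monomials `M`
  and POSITIVE analytic units `e` near the closed cube (real-root factors `(w_k − w_l) + w·gap`,
  conjugate-pair factors `(t − Re ρ)² + (Im ρ)²`; single terms are written `M(e/2) + M(e/2)`).

## The seven stubs (all landed) and the composition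

* `stub_chartCompiler` (M) — FORMAT atlas of `K.domain` (integrand `1`) ⇒ `[K] ≡ c ∈ cubicalSpan`:
  one `KZ.changeOfVariablesRel` per chart, domain additivity over the disjoint a.e. cover, null sets
  are relations, open cube → closed cube across its null boundary, tame cube class.
* `stub_cubeMonomializationOne` (S–M) — `E(1)`: cut a bounded semialgebraic `B ⊆ ℝ` at the real roots,
  affine charts of the intervals; `Q(a + w(b − a)) = w^{m}(1 − w)^{m'} · unit`.
* `stub_jungPrepare` (XL) — `E(d) ∧ AJ(d) ∧ DIV(d) ⇒ PREP(d)` (`d ≥ 1`): CAD of `B` adapted to the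
  family; shear `t ↦ t + c·x` (`c ∈ ℚᵈ`) to make the product `R` monic in `t`; midpoint augmentation
  `R⁺ = rad Res_s(R(s), R(2t − s))` (real parts of complex roots become real roots, all wall differences
  divide `disc_t R⁺`); `E(d)` on each base cell for `{disc_t R⁺, lc's}`; dyadic localisation and
  ramification; `AJ(d)`; `DIV(d)` for root differences; slab charts `t = w_k(s) + w·(w_{k+1} − w_k)(s)`.
* `stub_jungFinish` (M–L) — `TORIC(d+1) ∧ PREP(d) ⇒ E(d+1)`: dyadic localisation of the `(d+1)`-cube
  (far-face factors become units), simplicial toric charts making all exponent pairs comparable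
  (`M₁u₁ + M₂u₂ = M_min · unit`, then `(…)² + M₅u₅` likewise), composition of FORMAT charts, null images.
* `stub_abhyankarJung` (XL, the lead's) — `AJ(d)` for all `d`.
* `stub_toricPrincipalization` (M–L) — `TORIC(n)` for all `n`.
* `stub_rootDifferenceDivisor` (M–L) — `DIV(d)` for all `d`.

STATUS 2026-08-17T14Z: stubs S1 (p143039), S2 (p143476), S3 (p163096: JungPrepare, global assembly of the
Literature chart package `JungPreparation.exists_chart_package`), S5 (p145564: Abhyankar–Jung PROVED, Literature
`Analysis/Complex/{PolynomialRootCover,AbhyankarJungAnalytic,AbhyankarJungReal}`), S6 (p144295), S7 (p143678)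
and S4 (p164189: JungFinish, via the Literature repair theorem `exists_fin_atlas_cubeMonomial_of_binomialForm`,
p163904) are ALL LANDED and imported below: this file is sorry-free and closes the crux.

Composition: `E(1)`; `E(d) ⇒ E(d+1)` (`d ≥ 1`) by JungPrepare + JungFinish; `E(m+3)` with the empty
family is an atlas; the compiler gives `c ∈ cubicalSpan`; the landed reduction gives the crux.
Disproof.lean (cdisprove cycle 1): no kill; its refuted strengthenings (no cube terms / dimension-0
cubes only) do not concern this statement.
-/

noncomputable section

open Set MeasureTheory
open Literature.ModelTheory.ExponentialFields (IsSemialgebraic)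
open Literature.NumberTheory.Transcendental
open Literature.NumberTheory.Transcendental.KZ

namespace Summit.KontsevichZagierPeriods.SymplecticScissors.CubeNashNormalForm

/-! ## The seven landed stubs (imported; referenced by their fully qualified names)

* S1 `CubeNashNormalFormChartCompiler.stub_chartCompiler` (p143039) — FORMAT atlas ⇒ `[K] ≡ c ∈ cubicalSpan`.
* S2 `CubeNashNormalFormCubeMonomializationOne.stub_cubeMonomializationOne` (p143476) — `E(1)`.
* S3 `CubeNashNormalFormJungPrepare.stub_jungPrepare` (p163096) — `E(d) ∧ AJ(d) ∧ DIV(d) ⇒ PREP(d)`.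
* S4 `CubeNashNormalFormJungFinish.stub_jungFinish` (p164189) — `TORIC(d+1) ∧ PREP(d) ⇒ E(d+1)`.
* S5 `CubeNashNormalFormAbhyankarJung.stub_abhyankarJung` (p145564) — `AJ(d)` (Abhyankar–Jung).
* S6 `CubeNashNormalFormToricPrincipalization.stub_toricPrincipalization` (p144295) — `TORIC(n)`.
* S7 `CubeNashNormalFormRootDifferenceDivisor.stub_rootDifferenceDivisor` (p143678) — `DIV(d)`.
(all in namespace `Summit.KontsevichZagierPeriods.SymplecticScissors`). -/

/-! ## Composition -/

/-- **Cube-monomialization `E(d)` for every `d ≥ 1`** (the card's `CubeMonomialization d`), by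
Jung's induction: `E(1)` is stub S2; `E(d) ⇒ E(d+1)` (`d ≥ 1`) is JungPrepare (with Abhyankar–Jung
and the divisor lemma) followed by JungFinish (with the toric charts).
[Jung 1908; Kollár 2007, §2.3; Bierstone–Milman 1988, Thm. 0.2] -/
theorem cubeMonomialization_of_le (d : ℕ) (hd : 1 ≤ d) : (∀ (B : Set (Fin d → ℝ)), IsSemialgebraic ℚ B → Bornology.IsBounded B → ∀ (k : ℕ) (Q : Fin k → MvPolynomial (Fin d) ℚ), (∀ j, Q j ≠ 0) → ∃ (N : ℕ) (Φ : Fin N → (Fin d → ℝ) → (Fin d → ℝ)), (∀ i, (AnalyticOnNhd ℝ (Φ i) (Set.pi Set.univ (fun _ : Fin d => Set.Icc (0:ℝ) 1)) ∧ IsSemialgebraicMapOn ℚ (Set.pi Set.univ (fun _ : Fin d => Set.Ioo (0:ℝ) 1)) (Φ i) ∧ Set.InjOn (Φ i) (Set.pi Set.univ (fun _ : Fin d => Set.Ioo (0:ℝ) 1)) ∧ ∀ x ∈ Set.pi Set.univ (fun _ : Fin d => Set.Ioo (0:ℝ) 1), (fderiv ℝ (Φ i) x).det ≠ 0)) ∧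 (∀ i, Φ i '' Set.pi Set.univ (fun _ : Fin d => Set.Ioo (0:ℝ) 1) ⊆ B) ∧ Pairwise (fun i i' => Disjoint (Φ i '' Set.pi Set.univ (fun _ : Fin d => Set.Ioo (0:ℝ) 1)) (Φ i' '' Set.pi Set.univ (fun _ : Fin d => Set.Ioo (0:ℝ) 1))) ∧ MeasureTheory.volume (B \ ⋃ i, Φ i '' Set.pi Set.univ (fun _ : Fin d => Set.Ioo (0:ℝ) 1)) = 0 ∧ ∀ i j, (∃ U : Set (Fin d → ℝ), IsOpen U ∧ Set.pi Set.univ (fun _ : Fin d => Set.Icc (0:ℝ) 1) ⊆ U ∧ ∃ (a b : Fin d → ℕ) (e : (Fin d → ℝ) → ℝ), AnalyticOnNhd ℝ e U ∧ (∀ x ∈ U, e x ≠ 0) ∧ ∀ x ∈ U, (fun x => MvPolynomial.aeval (Φ i x) (Q j)) x = (∏ i, x i ^ a i * (1 - x i) ^ b i) * e x)) := by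
  induction d, hd using Nat.le_induction with
  | base => exact CubeNashNormalFormCubeMonomializationOne.stub_cubeMonomializationOne
  | succ d hd ih =>
    exact CubeNashNormalFormJungFinish.stub_jungFinish d
      (CubeNashNormalFormToricPrincipalization.stub_toricPrincipalization (d + 1))
      (CubeNashNormalFormJungPrepare.stub_jungPrepare d hd ih
        (CubeNashNormalFormAbhyankarJung.stub_abhyankarJung d)
        (CubeNashNormalFormRootDifferenceDivisor.stub_rootDifferenceDivisor d))

/-- **Tame cell atlas of a bounded solid** (= the registered `stub_tameCellAtlas` /
`stub_localUniformization` of the two sibling skeletons, in this line's FORMAT): `E(m+3)` with the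
empty family of polynomials. [Hironaka 1973 (rectilinearization); Bierstone–Milman 1988, Thm. 0.2] -/
theorem exists_atlas (m : ℕ) (S : Set (Fin (m + 3) → ℝ)) (hS : IsSemialgebraic ℚ S)
    (hb : Bornology.IsBounded S) :
    ∃ (N : ℕ) (Φ : Fin N → (Fin (m + 3) → ℝ) → (Fin (m + 3) → ℝ)), (∀ i, (AnalyticOnNhd ℝ (Φ i) (Set.pi Set.univ (fun _ : Fin (m + 3) => Set.Icc (0:ℝ) 1)) ∧ IsSemialgebraicMapOn ℚ (Set.pi Set.univ (fun _ : Fin (m + 3) => Set.Ioo (0:ℝ) 1)) (Φ i) ∧ Set.InjOn (Φ i) (Set.pi Set.univ (fun _ : Fin (m + 3) => Set.Ioo (0:ℝ) 1)) ∧ ∀ x ∈ Set.pi Set.univ (fun _ : Fin (m + 3) => Set.Ioo (0:ℝ) 1), (fderiv ℝ (Φ i) x).det ≠ 0)) ∧ (∀ i, Φ i '' Set.pi Set.univ (fun _ : Fin (m + 3) => Set.Ioo (0:ℝ) 1) ⊆ S) ∧ Pairwise (fun i i' => Disjoint (Φ i '' Set.pi Set.univ (fun _ : Fin (m + 3) =>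 Set.Ioo (0:ℝ) 1)) (Φ i' '' Set.pi Set.univ (fun _ : Fin (m + 3) => Set.Ioo (0:ℝ) 1))) ∧ MeasureTheory.volume (S \ ⋃ i, Φ i '' Set.pi Set.univ (fun _ : Fin (m + 3) => Set.Ioo (0:ℝ) 1)) = 0 := by
  obtain ⟨N, Φ, hF, hsub, hdisj, hnull, -⟩ := cubeMonomialization_of_le (m + 3) (by omega) S hS hb 0
    (fun j => Fin.elim0 j) (fun j => Fin.elim0 j)
  exact ⟨N, Φ, hF, hsub, hdisj, hnull⟩

/-- **The hypothesis of the landed reduction**: every bounded integrand-`1` solid of dimension `≥ 3` is,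
modulo `KZ.relations`, in the span of the tame cube classes (atlas + compiler).
[Kontsevich–Zagier 2001, §1.2; Viu-Sos 2021, Thm. 1.1] -/
theorem boundedCubeResolution_three (m : ℕ) (K : IntegralRep (m + 3))
    (hKb : Bornology.IsBounded K.domain) (hK1 : ∀ x ∈ K.domain, K.integrand x = 1) :
    ∃ c : FormalRep, c ∈ Summit.KontsevichZagierPeriods.FurushoPentagon.ReducedPeriodRing.cubicalSpan ∧
      of K - c ∈ relations := by
  obtain ⟨N, Φ, hF, hsub, hdisj, hnull⟩ := exists_atlas m K.domain K.isSemialgebraic_domain hKb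
  obtain ⟨c, hc, e⟩ :=
    CubeNashNormalFormChartCompiler.stub_chartCompiler (m + 3) K hK1 N Φ hF hsub hdisj hnull
  exact ⟨c, hc, e⟩

/-- **The crux by name (home decl, route LiftingCriteria), modulo the seven stubs.**
[Kontsevich–Zagier 2001, §1.2; Viu-Sos 2021, Thm. 1.1] -/
theorem cubeNashNormalForm_proof :
    Summit.KontsevichZagierPeriods.KontsevichZagierPeriods.Theses.LiftingCriteria.CubeNashNormalForm :=
  Summit.KontsevichZagierPeriods.LiftingCriteria.CubeNashNormalFormDimLeOne.cubeNashNormalForm_of_boundedCubeResolution_three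
    boundedCubeResolution_three

/-- The same conclusion for the SymplecticScissors route decl of the shared item (byte-identical body).
[Kontsevich–Zagier 2001, §1.2] -/
theorem cubeNashNormalForm_symplecticScissors_proof :
    Summit.KontsevichZagierPeriods.KontsevichZagierPeriods.Theses.SymplecticScissors.CubeNashNormalForm :=
  cubeNashNormalForm_proof

/-- The same conclusion for the DimensionBudget route decl of the shared item (byte-identical body).
[Kontsevich–Zagier 2001, §1.2] -/
theorem cubeNashNormalForm_dimensionBudget_proof :
    Summit.KontsevichZagierPeriods.KontsevichZagierPeriods.Theses.DimensionBudget.CubeNashNormalForm :=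
  cubeNashNormalForm_proof

end Summit.KontsevichZagierPeriods.SymplecticScissors.CubeNashNormalForm

end
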